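import Summits.NavierStokesRegularity.NavierStokesRegularity.Theorems.LandauTailHomSteadyProfileExistsCalculus
import Literature.Analysis.FluidPDE.LandauSolutions
import Literature.Analysis.FluidPDE.HomogeneousEuler

/-!
# Route `LandauTail`, item `HomSteadyProfileExists` (stmt-NavierStokesRegularity-1951) — helper 2:
# first-order structure of Landau's solution `U = (P/2) x + β a`

Support file (`--supports stmt-NavierStokesRegularity-1951`). With `r = |x|`, `s = ⟪a, x⟫`,
`D = c r − s` (`|a| = 1`, `|c| > 1`), Landau's solution `landauAxisField a c` and pressure
`P = landauAxisPressure a c = 4(cs − r)/(r D²)` (Literature/Analysis/FluidPDE/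
SverakLandauClassification; Karch–Pilarczyk 2011, §1; Lemarié-Rieusset 2016, (10.44)) satisfy,
EVERYWHERE (junk values included),

  `U = (P/2) x + β a`,  `β = 2/D`     (`landauAxisField_eq`),

and at every `x ≠ 0`: `∂ₐβ = −P/2`, `Dβ(x) x = −β` (Euler, degree `−1`), `DP(x) x = −2P` (Euler,
degree `−2`), the derivative `DU(x) h = (P/2) h + (DP(x)h/2) x + (Dβ(x)h) a`, whence

* `div U = 3P/2 + DP(x)x/2 + ∂ₐβ = 3P/2 − P − P/2 = 0` (`divergence_landauAxisField`),
* `(U·∇)U = (−P²/4 + β ∂ₐP/2) x − (Pβ/2) a` (`convect_landauAxisField`),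
* `∇P = Σᵢ (∂ᵢP) eᵢ` (`gradient_eq_sum_fderiv_smul`).

The second-order half (Leibniz for `ΔU`, `ΔP = β∂ₐP − P²/2`) and the momentum equation are in
the sibling file `…Momentum`.

References: L. D. Landau, Dokl. Akad. Nauk SSSR 43 (1944) 286–288; P. G. Lemarié-Rieusset,
*The Navier–Stokes problem in the 21st century* (2016), Thm 10.13; G. Karch, D. Pilarczyk,
Arch. Ration. Mech. Anal. 202 (2011), §1.
-/

noncomputable section

open Set Filter Module
open scoped Laplacian InnerProductSpace RealInnerProductSpace Topology
open Literature.Analysis.PDE.LoewnerNirenberg Literature.Analysis.FluidPDE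

-- the summit namespace `…NavierStokesRegularity.NavierStokesRegularity…` is the tree convention
set_option linter.dupNamespace false

namespace Summit.NavierStokesRegularity.NavierStokesRegularity.Theorems.LandauTail

/-! ### Two frame identities -/

section Frame

variable {E : Type*} [NormedAddCommGroup E] [InnerProductSpace ℝ E]

/-- `Σᵢ L(bᵢ) ⟪bᵢ, v⟫ = L v` for a linear functional `L` and an orthonormal basis `b`. [folklore] -/
theorem sum_apply_mul_inner {ι : Type*} [Fintype ι] (b : OrthonormalBasis ι ℝ E) (L : E →L[ℝ] ℝ)
    (v : E) : ∑ i, L (b i) * ⟪b i, v⟫ = L v := by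
  conv_rhs => rw [← b.sum_repr' v]
  rw [map_sum]
  exact Finset.sum_congr rfl fun i _ => by rw [map_smul, smul_eq_mul, mul_comm]

/-- **The gradient in a frame**: `∇f(x) = Σᵢ (∂ᵢ f)(x) bᵢ` for an orthonormal basis `b`
(Riesz: `⟪∇f, h⟫ = Df h`). [folklore] -/
theorem gradient_eq_sum_fderiv_smul [CompleteSpace E] {ι : Type*} [Fintype ι]
    (b : OrthonormalBasis ι ℝ E) (f : E → ℝ) (x : E) :
    gradient f x = ∑ i, (fderiv ℝ f x (b i)) • b i := by
  have h : ∀ i, fderiv ℝ f x (b i) = ⟪gradient f x, b i⟫ := fun i => by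
    rw [gradient, InnerProductSpace.toDual_symm_apply]
  simp_rw [h]
  exact (sum_inner_smul_eq b _).symm

end Frame

/-! ### Landau's solution in the form `U = (P/2) x + β a` -/

section Landau

variable {a : EuclideanSpace ℝ (Fin 3)} {c : ℝ} {x : EuclideanSpace ℝ (Fin 3)}

/-- **`U = (P/2) x + β a` everywhere**: `landauAxisField a c y = (P(y)/2) y + (2/(c|y| − ⟪a,y⟫)) a`
with `P = landauAxisPressure a c` (for `|a| = 1`, `|c| > 1`; at `y = 0` both sides are the junk
value `0`). Indeed `2((c²−1)r²/D² − 1)/r² − 2s/(D r²) = 2(cs − r)/(r D²) = P/2`. [folklore] -/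
theorem landauAxisField_eq (ha : ‖a‖ = 1) (hc : 1 < |c|) :
    landauAxisField a c = fun y =>
      (2⁻¹ * landauAxisPressure a c y) • y + (2 / (c * ‖y‖ - ⟪a, y⟫)) • a := by
  funext y
  rcases eq_or_ne y 0 with rfl | hy
  · simp [landauAxisField, landauAxisPressure]
  · have hr : ‖y‖ ≠ 0 := norm_ne_zero_iff.2 hy
    have hD := landauAxis_denom_ne_zero ha hc hy
    simp only [landauAxisField, landauAxisPressure]
    ext i
    simp only [PiLp.add_apply, PiLp.smul_apply, PiLp.sub_apply, smul_eq_mul]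
    field_simp
    ring

/-- The Landau pressure `P = 4(c⟪a,x⟫ − |x|)/(|x|(c|x| − ⟪a,x⟫)²)` is smooth (indeed analytic) at
every `x ≠ 0`. [folklore] -/
theorem contDiffAt_landauAxisPressure (ha : ‖a‖ = 1) (hc : 1 < |c|) (hx : x ≠ 0)
    {n : WithTop ℕ∞} : ContDiffAt ℝ n (landauAxisPressure a c) x := by
  have hnorm : ContDiffAt ℝ n (fun y : EuclideanSpace ℝ (Fin 3) => ‖y‖) x := contDiffAt_norm ℝ hx
  have hinner : ContDiffAt ℝ n (fun y : EuclideanSpace ℝ (Fin 3) => ⟪a, y⟫) x :=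
    (contDiff_inner_right a).contDiffAt
  unfold landauAxisPressure
  exact (contDiffAt_const.mul ((contDiffAt_const.mul hinner).sub hnorm)).div
    (hnorm.mul ((contDiffAt_landauDen c a hx).pow 2))
    (mul_ne_zero (norm_ne_zero_iff.2 hx) (pow_ne_zero 2 (landauAxis_denom_ne_zero ha hc hx)))

/-- Landau's solution is smooth at every `x ≠ 0`. [folklore] -/
theorem contDiffAt_landauAxisField (ha : ‖a‖ = 1) (hc : 1 < |c|) (hx : x ≠ 0)
    {n : WithTop ℕ∞} : ContDiffAt ℝ n (landauAxisField a c) x := by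
  rw [landauAxisField_eq ha hc]
  exact ((contDiffAt_const.mul (contDiffAt_landauAxisPressure ha hc hx)).smul contDiffAt_id).add
    ((contDiffAt_landauBeta ha hc hx).smul contDiffAt_const)

/-- The Landau pressure is differentiable at every `x ≠ 0`. [folklore] -/
theorem differentiableAt_landauAxisPressure (ha : ‖a‖ = 1) (hc : 1 < |c|) (hx : x ≠ 0) :
    DifferentiableAt ℝ (landauAxisPressure a c) x :=
  (contDiffAt_landauAxisPressure ha hc hx (n := 1)).differentiableAt one_ne_zero

/-- `β = 2/(c|x| − ⟪a,x⟫)` is differentiable at every `x ≠ 0`. [folklore] -/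
theorem differentiableAt_landauBeta (ha : ‖a‖ = 1) (hc : 1 < |c|) (hx : x ≠ 0) :
    DifferentiableAt ℝ (fun y : EuclideanSpace ℝ (Fin 3) => 2 / (c * ‖y‖ - ⟪a, y⟫)) x :=
  (hasFDerivAt_landauBeta ha hc hx).differentiableAt

/-- **Euler's relation for the pressure** (homogeneous of degree `−2`): `DP(x) x = −2 P(x)`. [folklore] -/
theorem fderiv_landauAxisPressure_self (ha : ‖a‖ = 1) (hc : 1 < |c|) (hx : x ≠ 0) :
    fderiv ℝ (landauAxisPressure a c) x x = -2 * landauAxisPressure a c x := by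
  have h := fderiv_apply_self_of_smul_eq_rpow_smul (Φ := landauAxisPressure a c) (x := x)
    (m := -2) (fun t ht => by
      rw [Real.rpow_neg ht.le, Real.rpow_two, smul_eq_mul]
      exact landauAxisPressure_smul a c ht x)
    (differentiableAt_landauAxisPressure ha hc hx)
  rw [h, smul_eq_mul]

/-- **Euler's relation for `β`** (homogeneous of degree `−1`): `Dβ(x) x = −β(x)`. [folklore] -/
theorem fderiv_landauBeta_self (ha : ‖a‖ = 1) (hc : 1 < |c|) (hx : x ≠ 0) :
    fderiv ℝ (fun y : EuclideanSpace ℝ (Fin 3) => 2 / (c * ‖y‖ - ⟪a, y⟫)) x x =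
      -(2 / (c * ‖x‖ - ⟪a, x⟫)) := by
  have hD := landauAxis_denom_ne_zero ha hc hx
  have hr : ‖x‖ ≠ 0 := norm_ne_zero_iff.mpr hx
  rw [fderiv_landauBeta_apply ha hc hx, inner_sub_left, inner_smul_left, real_inner_self_eq_norm_sq,
    RCLike.conj_to_real]
  field_simp

/-- **`∂ₐβ = −P/2`**: `Dβ(x) a = −landauAxisPressure a c x / 2` (`|a| = 1`). [folklore] -/
theorem fderiv_landauBeta_axis (ha : ‖a‖ = 1) (hc : 1 < |c|) (hx : x ≠ 0) :
    fderiv ℝ (fun y : EuclideanSpace ℝ (Fin 3) => 2 / (c * ‖y‖ - ⟪a, y⟫)) x a =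
      -(2⁻¹ * landauAxisPressure a c x) := by
  have hD := landauAxis_denom_ne_zero ha hc hx
  have hr : ‖x‖ ≠ 0 := norm_ne_zero_iff.mpr hx
  rw [fderiv_landauBeta_apply ha hc hx, inner_sub_left, inner_smul_left, real_inner_comm a x,
    real_inner_self_eq_norm_sq, ha, RCLike.conj_to_real, landauAxisPressure]
  field_simp
  ring

/-- **The derivative of Landau's solution** at `x ≠ 0`:
`DU(x) = (P/2) id + (DP(x)·/2) ⊗ x + (Dβ(x)·) ⊗ a`. [folklore] -/
theorem hasFDerivAt_landauAxisField (ha : ‖a‖ = 1) (hc : 1 < |c|) (hx : x ≠ 0) :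
    HasFDerivAt (landauAxisField a c)
      ((2⁻¹ * landauAxisPressure a c x) • ContinuousLinearMap.id ℝ (EuclideanSpace ℝ (Fin 3)) +
          ((2⁻¹ : ℝ) • fderiv ℝ (landauAxisPressure a c) x).smulRight x +
        (fderiv ℝ (fun y : EuclideanSpace ℝ (Fin 3) => 2 / (c * ‖y‖ - ⟪a, y⟫)) x).smulRight a)
      x := by
  rw [landauAxisField_eq ha hc]
  have hP := (differentiableAt_landauAxisPressure ha hc hx).hasFDerivAt.const_mul (2⁻¹ : ℝ)
  have hβ := (differentiableAt_landauBeta ha hc hx).hasFDerivAt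
  exact (hP.smul (hasFDerivAt_id x)).add (hβ.smul_const a)

/-- Directional form of the derivative of Landau's solution:
`DU(x) h = (P/2) h + (DP(x) h/2) x + (Dβ(x) h) a`. [folklore] -/
theorem fderiv_landauAxisField_apply (ha : ‖a‖ = 1) (hc : 1 < |c|) (hx : x ≠ 0)
    (h : EuclideanSpace ℝ (Fin 3)) :
    fderiv ℝ (landauAxisField a c) x h =
      (2⁻¹ * landauAxisPressure a c x) • h + (2⁻¹ * fderiv ℝ (landauAxisPressure a c) x h) • x +
        (fderiv ℝ (fun y : EuclideanSpace ℝ (Fin 3) => 2 / (c * ‖y‖ - ⟪a, y⟫)) x h) • a := by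
  rw [(hasFDerivAt_landauAxisField ha hc hx).fderiv]
  simp only [add_apply, smul_apply, ContinuousLinearMap.smulRight_apply,
    ContinuousLinearMap.id_apply, smul_eq_mul]

/-- **Landau's solution is divergence free off the origin**:
`div U = 3P/2 + DP(x)x/2 + ∂ₐβ = 3P/2 − P − P/2 = 0` (Landau 1944; Lemarié-Rieusset 2016,
Thm 10.13; Karch–Pilarczyk 2011, §1: "`div v_c = 0` … for every `x ∈ ℝ³ ∖ {0}`"). [folklore] -/
theorem divergence_landauAxisField (ha : ‖a‖ = 1) (hc : 1 < |c|) (hx : x ≠ 0) :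
    VectorCalculus.divergence (landauAxisField a c) x = 0 := by
  set b := EuclideanSpace.basisFun (Fin 3) ℝ
  have hbb : ∀ i, ⟪b i, b i⟫ = (1 : ℝ) := fun i => by
    rw [orthonormal_iff_ite.1 b.orthonormal, if_pos rfl]
  rw [divergence_eq_sum_inner_fderiv b]
  simp_rw [fderiv_landauAxisField_apply ha hc hx, inner_add_right, inner_smul_right, hbb, mul_one]
  rw [Finset.sum_add_distrib, Finset.sum_add_distrib]
  have h1 : ∑ i, 2⁻¹ * fderiv ℝ (landauAxisPressure a c) x (b i) * ⟪b i, x⟫ =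
      2⁻¹ * fderiv ℝ (landauAxisPressure a c) x x := by
    rw [← sum_apply_mul_inner b (fderiv ℝ (landauAxisPressure a c) x) x, Finset.mul_sum]
    exact Finset.sum_congr rfl fun i _ => by ring
  have h2 : ∑ i, fderiv ℝ (fun y : EuclideanSpace ℝ (Fin 3) => 2 / (c * ‖y‖ - ⟪a, y⟫)) x (b i) *
      ⟪b i, a⟫ = fderiv ℝ (fun y : EuclideanSpace ℝ (Fin 3) => 2 / (c * ‖y‖ - ⟪a, y⟫)) x a :=
    sum_apply_mul_inner b _ a
  rw [h1, h2, fderiv_landauAxisPressure_self ha hc hx, fderiv_landauBeta_axis ha hc hx]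
  simp only [Finset.sum_const, Finset.card_univ, Fintype.card_fin, nsmul_eq_mul]
  push_cast
  ring

/-- **The convective term of Landau's solution** at `x ≠ 0`:
`(U·∇)U = (−P²/4 + β ∂ₐP/2) x − (P β/2) a`, from `DU(x)U` with `U = (P/2)x + βa` and the Euler
relations `DP(x)x = −2P`, `Dβ(x)x = −β`, `∂ₐβ = −P/2`. [folklore] -/
theorem convect_landauAxisField (ha : ‖a‖ = 1) (hc : 1 < |c|) (hx : x ≠ 0) :
    convect (landauAxisField a c) (landauAxisField a c) x =
      (-(2⁻¹ * landauAxisPressure a c x) ^ 2 +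
          2⁻¹ * ((2 / (c * ‖x‖ - ⟪a, x⟫)) * fderiv ℝ (landauAxisPressure a c) x a)) • x -
        (2⁻¹ * landauAxisPressure a c x * (2 / (c * ‖x‖ - ⟪a, x⟫))) • a := by
  rw [convect_apply, fderiv_landauAxisField_apply ha hc hx]
  have hU : landauAxisField a c x =
      (2⁻¹ * landauAxisPressure a c x) • x + (2 / (c * ‖x‖ - ⟪a, x⟫)) • a := by
    rw [landauAxisField_eq ha hc]
  rw [hU]
  simp only [map_add, map_smul, smul_eq_mul, fderiv_landauAxisPressure_self ha hc hx,
    fderiv_landauBeta_self ha hc hx, fderiv_landauBeta_axis ha hc hx]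
  ext i
  simp only [PiLp.add_apply, PiLp.smul_apply, PiLp.sub_apply, smul_eq_mul]
  ring

end Landau

end Summit.NavierStokesRegularity.NavierStokesRegularity.Theorems.LandauTail
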